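import Summits.ABC.IUTFork.Cor312LicenceShallowMultiSlotLicence
import Summits.ABC.IUTFork.Thm311RealIsmDHOrbitSpan
import HarnessLib

/-!
# R-H candidate H⋆ (D-0079 RESCUE sub-cell R-H, lens NEARMISS, seat abc-iut-lens-nearmiss-2): the LATTICE-LEVEL
# MULTI-SLOT WINDOW `HStarLatticeLevelWindow` — RP-I06's «q-pilot inside a shell-orbit of the Θ-pilot» re-typed at the
# granularity the sharp (Ind2) actually sees: `p`-LEVELS in the honest log-shell lattice `I_x = (p^*)⁻¹·log_p(𝒪_x^×)`,
# one level datum per CAPSULE SLOT, at EVERY place `x | p` (tame or wild)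

FOLDER SKETCH (planner seat; statements = claim-tagged `def … : Prop`, never Literature facts; M1 `MoverOfLevel` is the
named missing mover lemma of the near-miss analysis, carried as a PREMISE, never asserted). TAKES NO SIDE on [IUTchIII]
Cor. 3.12 or on any author; nothing here asserts abc proved or refuted; typed ≠ proved ≠ endorsed.

NEAR-MISS MEASURED (DEFICIT.md of this seat). The honest single-shell reading I06⋆ = `Repair.CandInternal11Gap.HQShellOrbitStar`
prices, at a tame place (`e ≤ p − 2`), to `(j²−1)·m_q ≤ e − 1` (one log-shell radius; `Repair.CandInternal2NoGo.star_iff_price`,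
KS threshold `δ⋆_j = j² − 1`), whereas the kernel's EXACT tame dichotomy for the sharp genuine setting
(`Cor312LicenceExplicitDepthExact`, `Cor312LicenceShallowMultiSlotLicence` §6) is `(j²−1)·m_q ≤ j·(e−1) + ((j²·m_q − 1) mod e)`:
the `j` PASSIVE capsule slots of the `(j+1)`-fold tensor packet each donate a full shell radius under Dupuy–Hilado's (Ind2)
(`Real.ismDH` = `Aut_{ℤ_p}(K_x : log_p 𝒪_x^×)`, transitive on primitive vectors: `exists_mem_ismDH_apply_eq_of_primitive`). I06⋆ is
therefore too strong by the factor ≈ `j` (top label `l⋆`), and is even REFUTED on the unramified-odd stratum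
(`Repair.CandInternal2Real.not_mem_jsq_smul_logShell_of_unramified`). The binding input that confines the inhabited theorems
(p439445, w5-d009) to TAME places is the evaluation `log_p(𝒪_x^×) = 𝔪_x`; at wild places the same mechanism runs on LEVELS of the
(non-ball) lattice `I_x`. H⋆ below is that statement; `HStarLatticeLevelClosedForm` is its table-evaluable closed-form minorant
(inner radius `r_in(x) = ⌊e_x/(p−1)⌋ + 1`, [IUTchIV] Prop. 1.2 (i)); M1 `MoverOfLevel` is the one mover lemma that turns H⋆ into
branch C's hull clause S_H at the sharp genuine setting (proved modulo M1 below: `exists_qPinned_and_hull_settingPrVolSharp_of_levelWindow`).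
[cite: Mochizuki2012, IUTchIII Thm. 3.11 (i) (Ind2) p. 154; Cor. 3.12 p. 173–174; Step (xi-f) p. 184 l. 26–27]
[cite: Mochizuki2012, IUTchIV Prop. 1.1 p. 9; Prop. 1.2 (i)(ii) p. 10] [cite: DupuyHilado2025, §3.9, §4.9]
[cite: WeilBNT1967, Ch. II §2, Th. 1] [claim: Mochizuki2012, status: disputed] for every IUT locution.
-/

noncomputable section

open Set Function NumberField IsDedekindDomain
open scoped Pointwise

namespace Summit.ABC.IUTFork.Repair.RH.LatticeLevelWindow

open Thm311 Thm311.Real Cor312 Cor312.Setting Cor312Vol Literature.IUT.LogThetaLattice Literature.IUT.LogVolume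
open Literature.NumberTheory.NumberFields Literature.NumberTheory.GaloisRepresentations.Ultrametric

/-! ## 1. `p`-levels in the honest log-shell lattice of ONE place -/

section Local

variable {F : Type} [Field F] [NumberField F] {p : ℕ} [hp : Fact p.Prime]
  (v : HeightOneSpectrum (𝓞 F)) (hv : ((p : ℕ) : 𝓞 F) ∈ v.asIdeal)

/-- The honest log-shell lattice `I_v = (p^*)⁻¹·log_p(𝒪_v^×) ⊂ K_v` (our `Real.shell logv (inr v)` read in the rescaled
completion, `mem_shell_iff_mem_smul_logUnits`). [cite: Mochizuki2012, IUTchIII Def. 1.1 (i) p. 41; IUTchIV Prop. 1.2 p. 10]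
[claim: Mochizuki2012, status: disputed] -/
@[cite "Mochizuki2012" "IUTchIV Prop. 1.2 p. 10"]
def shellLattice : Set (RescaledCompletion F p v hv) :=
  ((pStar p : ℕ) : ℚ_[p])⁻¹ • (logUnits (RescaledCompletion F p v hv) : Set (RescaledCompletion F p v hv))

/-- `OnLevel v hv z k`: `z` lies on the EXACT `p`-level `k` of the log-shell lattice, `z ∈ p^k·I_v ∖ p^{k+1}·I_v`
(i.e. `p^{−k}·z` is a PRIMITIVE vector of `I_v`). [cite: WeilBNT1967, Ch. II §2] -/
@[cite "WeilBNT1967" "Ch. II §2, Th. 1"]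
def OnLevel (z : RescaledCompletion F p v hv) (k : ℤ) : Prop :=
  z ∈ ((p : ℚ_[p]) ^ k) • shellLattice v hv ∧ z ∉ ((p : ℚ_[p]) ^ (k + 1)) • shellLattice v hv

/-- `Primitive v hv y`: `y` is a PRIMITIVE vector of the log-shell lattice, `y ∈ I_v ∖ p·I_v` (part of a `ℤ_p`-basis;
the maximum of `‖·‖` on `I_v` is attained at a primitive vector). [cite: WeilBNT1967, Ch. II §2, Th. 1] -/
@[cite "WeilBNT1967" "Ch. II §2, Th. 1"]
def Primitive (y : RescaledCompletion F p v hv) : Prop :=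
  y ∈ shellLattice v hv ∧ y ∉ (p : ℚ_[p]) • shellLattice v hv

/-- `LevelReach v hv z N`: the LATTICE-LEVEL CERTIFICATE that the sharp (Ind2) can move `z` to norm `≥ N`: `z` is on some
exact level `k` and some PRIMITIVE lattice vector `y` has `N ≤ ‖p^k·y‖` ((Ind2) is transitive on primitive vectors, so some
`g` has `g z = p^k·y`; conversely every `g z` has this shape — the certificate is exact). [cite: DupuyHilado2025, §4.9]
[cite: WeilBNT1967, Ch. II §2, Th. 1] -/
@[cite "WeilBNT1967" "Ch. II §2, Th. 1"]
def LevelReach (z : RescaledCompletion F p v hv) (N : ℝ) : Prop :=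
  ∃ k : ℤ, OnLevel v hv z k ∧ ∃ y : RescaledCompletion F p v hv, Primitive v hv y ∧ N ≤ ‖((p : ℚ_[p]) ^ k) • y‖

/-- **M1 at one place: a lattice-level reach certificate IS realised by DH's (Ind2)** — `z = p^k·z₀`, `z₀` primitive; (Ind2) is
transitive on the primitive vectors of `p^k·I_v` (abc-iut-w5-d180 `exists_mem_ismDH_apply_eq_of_primitive` with content
`c = p^k·(p^*)⁻¹`), so some `g` has `g z = p^k·y` and `‖g z‖ = ‖p^k·y‖ ≥ N`. [cite: WeilBNT1967, Ch. II §2, Th. 1]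
[cite: DupuyHilado2025, §4.9] -/
theorem exists_mem_ismDH_of_levelReach {logv : PadicLogs F} (hlogp : LogvAnalyticAt p logv)
    {z : RescaledCompletion F p v hv} {N : ℝ} (h : LevelReach v hv z N) :
    ∃ g ∈ ismDH logv (.inr v), N ≤ ‖toR p v hv (g (ofR p v hv z))‖ := by
  obtain ⟨k, ⟨hzk, hzk1⟩, y, ⟨hy, hyp⟩, hN⟩ := h
  have hp0 : ((p : ℕ) : ℚ_[p]) ≠ 0 := Nat.cast_ne_zero.mpr hp.out.ne_zero
  have hpk0 : ((p : ℕ) : ℚ_[p]) ^ k ≠ 0 := zpow_ne_zero k hp0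
  simp only [shellLattice, smul_smul] at hzk hzk1 hy hyp
  have hk1 : ((p : ℕ) : ℚ_[p]) ^ (k + 1) * ((pStar p : ℕ) : ℚ_[p])⁻¹ =
      ((p : ℕ) : ℚ_[p]) * (((p : ℕ) : ℚ_[p]) ^ k * ((pStar p : ℕ) : ℚ_[p])⁻¹) := by
    rw [zpow_add_one₀ hp0]; ring
  rw [hk1] at hzk1
  have hy1 : (((p : ℕ) : ℚ_[p]) ^ k) • y ∈
      (((p : ℕ) : ℚ_[p]) ^ k * ((pStar p : ℕ) : ℚ_[p])⁻¹) • (logUnits (RescaledCompletion F p v hv) : Set (RescaledCompletion F p v hv)) := by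
    rw [← smul_smul]; exact Set.smul_mem_smul_set hy
  have hy2 : (((p : ℕ) : ℚ_[p]) ^ k) • y ∉
      (((p : ℕ) : ℚ_[p]) * (((p : ℕ) : ℚ_[p]) ^ k * ((pStar p : ℕ) : ℚ_[p])⁻¹)) •
        (logUnits (RescaledCompletion F p v hv) : Set (RescaledCompletion F p v hv)) := by
    rw [show ((p : ℕ) : ℚ_[p]) * (((p : ℕ) : ℚ_[p]) ^ k * ((pStar p : ℕ) : ℚ_[p])⁻¹) =
        ((p : ℕ) : ℚ_[p]) ^ k * (((p : ℕ) : ℚ_[p]) * ((pStar p : ℕ) : ℚ_[p])⁻¹) by ring, ← smul_smul,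
      Set.smul_mem_smul_set_iff₀ hpk0]
    exact hyp
  obtain ⟨g, hg, hgz⟩ := exists_mem_ismDH_apply_eq_of_primitive hlogp v hv hzk hzk1 hy1 hy2
  exact ⟨g, hg, hN.trans (le_of_eq (congrArg (‖·‖) hgz).symm)⟩

end Local

/-! ## 2. The candidate H⋆ at a pilot datum with q-ideles `tq` and Θ-ideles `t` -/

section Candidate

variable {F : Type} [Field F] [NumberField F] (X : PilotData F)
  (tq : ∀ (pp : Nat.Primes) (x : (thetaIndex X).Fibre (.inr pp)), haveI : Fact (pp : ℕ).Prime := ⟨pp.2⟩; kOf X pp.1 x)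
  (t : ∀ (pp : Nat.Primes) (_ : Fin X.lstar) (x : (thetaIndex X).Fibre (.inr pp)),
    haveI : Fact (pp : ℕ).Prime := ⟨pp.2⟩; kOf X pp.1 x)

/-- **H⋆ = `HStarLatticeLevelWindow` [R-H candidate, hypothesis — not a fact] (lens nearmiss, seat abc-iut-lens-nearmiss-2): the LATTICE-LEVEL MULTI-SLOT WINDOW.** At every prime `p` and
label `j ∈ {0,…,l⋆}` there are slot targets `R_x, N_x ≥ 0` (`x | p`) CERTIFIED BY LEVELS IN THE HONEST LOG-SHELL — `R_x` a reach of
the passive slot value `1`, `N_x` a reach of the active slot value `t_{Θ,j,x}` (`labelIdele`; `1` at `j = 0`) — such that at every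
capsule tuple `v⃗ = (v_0,…,v_j)` of places over `p`: `‖t_{q,v_j}‖ ≤ (∏_{a<j} R_{v_a})·N_{v_j}`. In orders at a place `w | p`
(all `x | p` alike): `(j²−1)·m_q ≤ D_act(w,j) + j·don(p)`, `don = β_I − e·lev_I(1)`, `D_act = j²m_q − e·lev_I(t_Θ) + β_I`
(`β_I` = outer radius exponent of `I_x`); tame: `don = e−1`, `D_act = (j²m_q−1) mod e` — the kernel's exact tame window.
HONEST STATUS: a HYPOTHESIS on the datum `(X, tq, t)`, weaker than I06⋆ where I06⋆ is refuted, implying S_H given M1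
(`exists_qPinned_and_hull_settingPrVolSharp_of_levelWindow`); OUR typed (Ind2) (Dupuy–Hilado), STRONGER-THAN-PRINT hull reading.
[cite: Mochizuki2012, IUTchIII Cor. 3.12 p. 173–174, Step (xi-f) p. 184 l. 26–27; Thm. 3.11 (i) (Ind2) p. 154]
[cite: DupuyHilado2025, §3.9, §4.9] [claim: Mochizuki2012, status: disputed] -/
@[claim "Mochizuki2012" "disputed"]
def HStarLatticeLevelWindow : Prop :=
  ∀ (pp : Nat.Primes) (j : (thetaIndex X).Label),
    haveI : Fact (pp : ℕ).Prime := ⟨pp.2⟩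
    ∃ R N : (thetaIndex X).Fibre (.inr pp) → ℝ,
      (∀ x, 0 ≤ R x ∧ LevelReach (placeOf X pp.1 x) (natCast_mem_placeOf X pp.1 x) (1 : kOf X pp.1 x) (R x)) ∧
      (∀ x, 0 ≤ N x ∧
        LevelReach (placeOf X pp.1 x) (natCast_mem_placeOf X pp.1 x) (labelIdele X t pp j x) (N x)) ∧
      ∀ e : (thetaIndex X).Caps j → (thetaIndex X).Fibre (.inr pp),
        ‖tq pp (e (Fin.last _))‖ ≤ (∏ a : Fin (j : ℕ), R (e a.castSucc)) * N (e (Fin.last _))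

open Classical in
/-- The CLOSED-FORM passive donation of a place `x | p`: `p^{1 − r_in(x)/e_x}` with `r_in(x) = ⌊e_x/(p−1)⌋ + 1` (the inner
radius: `𝔪_x^{r_in} ⊆ log_p(𝒪_x^×)`, [IUTchIV] Prop. 1.2 (i) / Neukirch II (5.5)), granted `p > 2` and `1 ∉ log_p(𝒪_x^×)` (i.e.
`lev_I(1) = 0`: no unit `u` with `log_p u = 1`, equivalently `ζ·exp_p(p) ∉ (K_x^×)^p` for all `ζ ∈ μ_{p^∞}(K_x)`); else `1` (no
donation claimed). Tame value: `p^{(e−1)/e} = ‖ϖ_x‖^{1−e_x}`. [cite: Mochizuki2012, IUTchIV Prop. 1.2 (i) p. 10]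
[cite: NeukirchANT1999, Ch. II Prop. (5.5)] [claim: Mochizuki2012, status: disputed] -/
@[cite "Mochizuki2012" "IUTchIV Prop. 1.2 (i) p. 10"]
def closedDonation (pp : Nat.Primes) (x : (thetaIndex X).Fibre (.inr pp)) : ℝ :=
  haveI : Fact (pp : ℕ).Prime := ⟨pp.2⟩
  if 2 < (pp : ℕ) ∧ (1 : kOf X pp.1 x) ∉ (logUnits (kOf X pp.1 x) : Set (kOf X pp.1 x)) then
    ((pp : ℕ) : ℝ) ^ (((1 : ℝ) - (((placeOf X pp.1 x).asIdeal.ramificationIdx ℤ / ((pp : ℕ) - 1) + 1 : ℕ) : ℝ) /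
      ((placeOf X pp.1 x).asIdeal.ramificationIdx ℤ : ℝ)))
  else 1

/-- **`HStarLatticeLevelClosedForm` — the table-evaluable minorant of H⋆ [R-H candidate, hypothesis — not a fact]** (implies H⋆ given [IUTchIV] Prop. 1.2 (i), M2): at every
prime `p`, label `j` and capsule tuple `v⃗`: `‖t_{q,v_j}‖ ≤ (∏_{a<j} closedDonation(v_a))·‖t_{Θ,j,v_j}‖`. In orders, all `x | p` with
ramification `e`, `p > 2`, `1 ∉ log_p(𝒪_x^×)`, realising ideles (`m_Θ(j) = j²·m_q`): **`(j²−1)·m_q ≤ j·(e − ⌊e/(p−1)⌋ − 1)`**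
(tame `e ≤ p−2`: `(j²−1)·m_q ≤ j·(e−1)`, abc-iut-w5-d009's `m_p`-form with `m_p = e`). Needs only `(p, e_x, m_q, j)` and one
boolean per place. [cite: Mochizuki2012, IUTchIV Prop. 1.2 (i) p. 10] [cite: DupuyHilado2025, §3.9, §4.9]
[claim: Mochizuki2012, status: disputed] -/
@[claim "Mochizuki2012" "disputed"]
def HStarLatticeLevelClosedForm : Prop :=
  ∀ (pp : Nat.Primes) (j : (thetaIndex X).Label),
    haveI : Fact (pp : ℕ).Prime := ⟨pp.2⟩
    ∀ e : (thetaIndex X).Caps j → (thetaIndex X).Fibre (.inr pp),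
      ‖tq pp (e (Fin.last _))‖ ≤ (∏ a : Fin (j : ℕ), closedDonation X pp (e a.castSucc)) * ‖labelIdele X t pp j (e (Fin.last _))‖

end Candidate

/-! ## 3. k2: H⋆ ⟹ S_H at the sharp genuine setting, modulo the ONE mover lemma M1 -/

section Assembly

variable {F : Type} [Field F] [NumberField F] (X : PilotData F) {logv : PadicLogs F} (hlog : LogvAnalytic logv)
  (M : Type) [Field M] [NumberField M]
  (archPk : ∀ (j : (thetaIndex X).Label) (vQ : (thetaIndex X).VQ), Set ((logShellsDH X logv).Packet j vQ))
  (archSub : ∀ (j : (thetaIndex X).Label) (v : (thetaIndex X).V),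
    Set ((logShellsDH X logv).Packet j ((thetaIndex X).over v)))
  (Ψ : ℤ → ∀ v : (thetaIndex X).V, v ∈ (thetaIndex X).Vbad → Set ((logShellsDH X logv).StarPacket v))
  (act : ℤ → ∀ v : (thetaIndex X).V, v ∈ (thetaIndex X).Vbad →
    (logShellsDH X logv).StarPacket v → Module.End ℚ ((logShellsDH X logv).StarPacket v))
  (Mmod : ℤ → ∀ j : (thetaIndex X).LabelStar, Set ((logShellsDH X logv).GlobalPacket j.1))
  (region : ℤ → ∀ j : (thetaIndex X).LabelStar, FinDivisor M → ∀ vQ : (thetaIndex X).VQ,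
    Set ((logShellsDH X logv).Packet j.1 vQ))
  (n : ℤ) {HT : Type} {LogLink : HT → HT → Type} {IsFull : ∀ {s t : HT}, LogLink s t → Prop}
  (lat : LGPGaussianLogThetaLattice LogLink IsFull)
  {Frd : Type} {IsoF : Frd → Frd → Type} {Ob : Frd → Type} {realify : Frd → Frd} {Strip : Type}
  {IsoS : Strip → Strip → Type} {Mv : ∀ v : (thetaIndex X).V, v ∈ (thetaIndex X).Vbad → Type}
  [∀ v h, Monoid (Mv v h)]
  (sig : GlobalLGPFrobenioidSignature (thetaIndex X).lstar (thetaIndex X).V (· ∈ (thetaIndex X).Vbad)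
    Frd IsoF Ob realify Strip IsoS Mv)
  (split : SplittingMonoids Mv) {ObΔ : Type} {N : ∀ v : (thetaIndex X).V, v ∈ (thetaIndex X).Vbad → Type}
  [∀ v h, Monoid (N v h)] (qData : QPilotData ObΔ N)
  (tq : ∀ (pp : Nat.Primes) (x : (thetaIndex X).Fibre (.inr pp)), haveI : Fact (pp : ℕ).Prime := ⟨pp.2⟩; kOf X pp.1 x)
  (t : ∀ (pp : Nat.Primes) (_ : Fin X.lstar) (x : (thetaIndex X).Fibre (.inr pp)),
    haveI : Fact (pp : ℕ).Prime := ⟨pp.2⟩; kOf X pp.1 x)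
  (htq0 : ∀ pp x, tq pp x ≠ 0)
  (htq1 : ∀ (pp : Nat.Primes) (x : (thetaIndex X).Fibre (.inr pp)),
    haveI : Fact (pp : ℕ).Prime := ⟨pp.2⟩; placeOf X pp.1 x ∉ X.S → ‖tq pp x‖ = 1)
  (col : ℤ → Column (logShellsDH X logv))

/-- **M1 (the near-miss's single missing mover lemma) as a named premise**: a lattice-level reach certificate at `x | p` IS
realised by some `g ∈ Real.ismDH logv x` (read through the presentation `φ_x = id`). Expected proof: `z = p^k·z₀` with `z₀`
primitive; replace `y` by the primitive `p^{−lev y}·y` (norm only grows); transitivity on primitive vectors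
(`exists_mem_ismDH_apply_eq_of_primitive`, abc-iut-w5-d180) gives `g z₀ = y₀`, so `‖g z‖ = ‖p^k‖·‖y₀‖ ≥ N`. Tame special case in the
tree: `exists_mem_ismDH_norm_one_ge_of_tame`, `exists_mem_ismDH_norm_labelIdele_ge_of_tame`. [cite: WeilBNT1967, Ch. II §2, Th. 1]
[cite: DupuyHilado2025, §4.9] -/
@[cite "DupuyHilado2025" "§4.9"]
def MoverOfLevel : Prop :=
  ∀ (pp : Nat.Primes) (x : (thetaIndex X).Fibre (.inr pp)),
    haveI : Fact (pp : ℕ).Prime := ⟨pp.2⟩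
    ∀ (z : kOf X pp.1 x) (Nz : ℝ),
      LevelReach (placeOf X pp.1 x) (natCast_mem_placeOf X pp.1 x) z Nz →
        ∃ g ∈ ismDH logv x.1, Nz ≤ ‖(presAt X hlog pp).φ x (g (((presAt X hlog pp).φ x).symm z))‖

/-- **M1 HOLDS (kernel-checked): every lattice-level reach certificate at a fibre point `x | p` is realised by DH's (Ind2)**
(`exists_mem_ismDH_of_levelReach` read through the presentation `φ_x = id`). [cite: WeilBNT1967, Ch. II §2, Th. 1]
[cite: DupuyHilado2025, §4.9] -/
theorem moverOfLevel_holds : MoverOfLevel X hlog := by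
  intro pp x
  haveI : Fact (pp : ℕ).Prime := ⟨pp.2⟩
  obtain ⟨x1, hx⟩ := x
  rcases x1 with w | v
  · exact absurd hx (by simp [thetaIndex])
  · intro z Nz hz
    obtain ⟨g, hg, hgn⟩ := exists_mem_ismDH_of_levelReach v (natCast_mem_placeOf X pp.1 ⟨.inr v, hx⟩) (hlog pp) hz
    exact ⟨g, hg, hgn⟩

/-- **k2 (packet level): H⋆ and M1 give the q-region below the Θ-hull at EVERY `(j, p)`** — by abc-iut-w5-d180's
`qRegion_subset_thetaHull_settingDHVolSharp_of_targets`. [cite: DupuyHilado2025, §3.9, §4.9] [claim: Mochizuki2012, status: disputed] -/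
theorem qRegion_subset_thetaHull_of_levelWindow (hM : MoverOfLevel X hlog) (h : HStarLatticeLevelWindow X tq t)
    (j : (thetaIndex X).Label) (pp : Nat.Primes) :
    (settingDHVolSharp X hlog M archPk archSub Ψ act Mmod region n lat sig split qData tq t htq0 htq1).qRegion j (.inr pp) ⊆
      (settingDHVolSharp X hlog M archPk archSub Ψ act Mmod region n lat sig split qData tq t htq0 htq1).thetaHull j (.inr pp) := by
  haveI : Fact (pp : ℕ).Prime := ⟨pp.2⟩
  obtain ⟨R, Nn, hR, hN, hle⟩ := h pp j
  exact qRegion_subset_thetaHull_settingDHVolSharp_of_targets X hlog M archPk archSub Ψ act Mmod region n lat sig split qData tq t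
    htq0 htq1 j pp R Nn (fun x => (hR x).1) (fun x => (hN x).1) (fun x => hM pp x 1 (R x) (hR x).2)
    (fun x => hM pp x (labelIdele X t pp j x) (Nn x) (hN x).2) hle

/-- **k2 (licence level): H⋆ and M1 give abc-iut-c312-1's (xi-f) `Licence` at the sharp settings.**
[claim: Mochizuki2012, status: disputed] -/
theorem licence_settingPrVolSharp_of_levelWindow (hM : MoverOfLevel X hlog) (h : HStarLatticeLevelWindow X tq t) :
    Thm311ToCor312.Licence (settingPrVolSharp X hlog M archPk archSub Ψ act Mmod region n lat sig split qData tq t htq0 htq1) := by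
  rw [licence_settingPrVolSharp_iff_settingDHVolSharp]
  intro i vQ
  cases vQ with
  | inl u =>
    exact qRegion_subset_thetaHull_settingDHVolSharp_inl X hlog M archPk archSub Ψ act Mmod region n lat sig split qData tq t htq0
      htq1 (labelSucc i) u
  | inr pp =>
    exact qRegion_subset_thetaHull_of_levelWindow X hlog M archPk archSub Ψ act Mmod region n lat sig split qData tq t htq0 htq1
      hM h (labelSucc i) pp

/-- **k2 (S_H level): H⋆ and M1 give branch C's hull-level antecedent «∃ ρ qK, QPinned ∧ PilotKummerCompatHull» at the sharp
genuine-shape setting `settingPrVolSharp`** (all labels, the label `0` included since H⋆ quantifies over it; any columns).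
Instantiated at `X := Cor312Prov.pilotDataOfK D K` with the chosen realising ideles this is the `hSHw` clause of the window
certificates (`Conditional.abc_of_SH_v8K_window` ff.). [claim: Mochizuki2012, status: disputed] -/
theorem exists_qPinned_and_hull_settingPrVolSharp_of_levelWindow (hM : MoverOfLevel X hlog) (h : HStarLatticeLevelWindow X tq t) :
    ∃ (ρ' : (∀ v : (thetaIndex X).V, v ∈ (thetaIndex X).Vbad → Set ((logShellsDH X logv).StarPacket v)) →
          ∀ (j : (thetaIndex X).Label) (vQ : (thetaIndex X).VQ), Set ((logShellsDH X logv).Packet j vQ))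
        (qK : ∀ v : (thetaIndex X).V, v ∈ (thetaIndex X).Vbad → Set ((logShellsDH X logv).StarPacket v)),
        QPinned ({ toSituation := situationPrVol X hlog M archPk archSub Ψ act Mmod region, col := col } :
            LatticeSituation (thetaIndex X))
          (settingPrVolSharp X hlog M archPk archSub Ψ act Mmod region n lat sig split qData tq t htq0 htq1) ρ' qK ∧
        PilotKummerCompatHull ({ toSituation := situationPrVol X hlog M archPk archSub Ψ act Mmod region, col := col } :
            LatticeSituation (thetaIndex X))
          (settingPrVolSharp X hlog M archPk archSub Ψ act Mmod region n lat sig split qData tq t htq0 htq1) ρ' qK := by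
  refine (Conditional.Antecedent.exists_qPinned_and_hull_iff
    ({ toSituation := situationPrVol X hlog M archPk archSub Ψ act Mmod region, col := col } : LatticeSituation (thetaIndex X))
    (settingPrVolSharp X hlog M archPk archSub Ψ act Mmod region n lat sig split qData tq t htq0 htq1)).2 fun j vQ => ?_
  cases vQ with
  | inl u =>
    exact qRegion_subset_thetaHull_settingDHVolSharp_inl X hlog M archPk archSub Ψ act Mmod region n lat sig split qData tq t htq0
      htq1 j u
  | inr pp =>
    exact qRegion_subset_thetaHull_of_levelWindow X hlog M archPk archSub Ψ act Mmod region n lat sig split qData tq t htq0 htq1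
      hM h j pp

/-- **k2, UNCONDITIONAL IN M1: H⋆ alone gives branch C's hull-level antecedent «∃ ρ qK, QPinned ∧ PilotKummerCompatHull» at
`settingPrVolSharp`** (M1 discharged by `moverOfLevel_holds`). [claim: Mochizuki2012, status: disputed] -/
theorem exists_qPinned_and_hull_settingPrVolSharp_of_levelWindow' (h : HStarLatticeLevelWindow X tq t) :
    ∃ (ρ' : (∀ v : (thetaIndex X).V, v ∈ (thetaIndex X).Vbad → Set ((logShellsDH X logv).StarPacket v)) →
          ∀ (j : (thetaIndex X).Label) (vQ : (thetaIndex X).VQ), Set ((logShellsDH X logv).Packet j vQ))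
        (qK : ∀ v : (thetaIndex X).V, v ∈ (thetaIndex X).Vbad → Set ((logShellsDH X logv).StarPacket v)),
        QPinned ({ toSituation := situationPrVol X hlog M archPk archSub Ψ act Mmod region, col := col } :
            LatticeSituation (thetaIndex X))
          (settingPrVolSharp X hlog M archPk archSub Ψ act Mmod region n lat sig split qData tq t htq0 htq1) ρ' qK ∧
        PilotKummerCompatHull ({ toSituation := situationPrVol X hlog M archPk archSub Ψ act Mmod region, col := col } :
            LatticeSituation (thetaIndex X))
          (settingPrVolSharp X hlog M archPk archSub Ψ act Mmod region n lat sig split qData tq t htq0 htq1) ρ' qK :=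
  exists_qPinned_and_hull_settingPrVolSharp_of_levelWindow X hlog M archPk archSub Ψ act Mmod region n lat sig split qData tq t
    htq0 htq1 col (moverOfLevel_holds X hlog) h

end Assembly

end Summit.ABC.IUTFork.Repair.RH.LatticeLevelWindow
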